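import Literature.MathematicalPhysics.QuantumLattice.SchwartzOrderedWedgeDensity

/-!
# Crux `DiagonalMirrorRPR` (stmt-QuantumFields-10604), stub `stub_rpClosure`: density of slab-ordered real product
# tensors with COMPACTLY SUPPORTED factors in the ordered wedge

Part of the proof of the registered stub `stub_rpClosure` (S4) of the skeleton
`Cruxes/DiagonalMirrorRPR/Lines/parity_bridge_cold_traces.lean` (crux `DiagonalMirrorRPR`, stmt-QuantumFields-10604,
routes `PencilRigidity` = `MirrorModularBoosts`), split by topic over the modules
`…StubRpClosureDefs` (vocabulary, frames) ← `…StubRpClosureLattice` (swap on the cover, expectations, lattice Gram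
positivity), `…StubRpClosureSupport` (support bookkeeping, test functions) and `…StubRpClosureDensity` (ordered-wedge
density with compact supports) ← `…StubRpClosure` (the limit argument and the stub).

This module (namespace `RpClosure`, generic in the dimension `d`): the set `slabOrderedCompactProducts d n` — the
tree's `slabOrderedProducts d n` with the extra clause `∀ i, HasCompactSupport (f i)` — and the ordered-wedge density
with compact supports (`stub_rpClosure_density`): every time-ordered `n`-point test function lies in the closure of its
`ℂ`-span.  The tree's proof of `IsTimeOrdered.mem_closure_span_slabOrderedProducts` is re-run verbatim; its box engine
`mem_closure_span_boxTensors` already produces factors supported in bounded open coordinate boxes, and that compactness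
is recorded instead of forgotten (cover insensitivity is stated for compactly supported test functions).

References: Osterwalder–Schrader, Comm. Math. Phys. 31 (1973) §2 pp. 86–87 (`𝒮_<`); the Fourier-series proof of the
density of `C_c^∞(X) ⊗ C_c^∞(Y)` in `C_c^∞(X × Y)` is textbook folklore.
-/

set_option autoImplicit false

noncomputable section

open scoped SchwartzMap
open Filter Topology
open Literature.MathematicalPhysics.QuantumLattice

namespace Summit.QuantumFields.YangMills.Cruxes.DiagonalMirrorRPR.ParityBridgeColdTraces

namespace RpClosure

/-! ## §D Density of slab-ordered COMPACTLY SUPPORTED real product tensors in the ordered wedge -/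

section Density

open Set

variable {d : ℕ} [NeZero d] {n : ℕ}

variable (d) in
/-- Slab-ordered real product tensors with compactly supported factors: `slabOrderedProducts d n` with the
extra clause `∀ i, HasCompactSupport (f i)` (the box engine produces such factors; the tree's set forgets it). -/
def slabOrderedCompactProducts (n : ℕ) : Set 𝓢((Fin n → EuclideanSpace ℝ (Fin d)), ℂ) :=
  {P | ∃ (f : Fin n → 𝓢(EuclideanSpace ℝ (Fin d), ℝ)) (lo hi : Fin n → ℝ),
    IsTensorOf P (fun i => ofRealTest (f i)) ∧ (∀ i, 0 < lo i) ∧ (∀ i, lo i ≤ hi i) ∧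
      (∀ i j, i < j → hi i < lo j) ∧
      (∀ i, tsupport (f i : EuclideanSpace ℝ (Fin d) → ℝ) ⊆ {x | lo i ≤ x 0 ∧ x 0 ≤ hi i}) ∧
      ∀ i, HasCompactSupport (f i : EuclideanSpace ℝ (Fin d) → ℝ)}

omit [NeZero d] in
/-- A closed coordinate box of `ℝ^d` is compact. -/
theorem isCompact_coordBox (l u : Fin d → ℝ) :
    IsCompact {x : EuclideanSpace ℝ (Fin d) | ∀ c, x c ∈ Icc (l c) (u c)} := by
  -- adapted from `BoxData.isCompact_blockK` (Literature/QuantumLattice/SchwartzTensorDensityProofs)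
  let Ψ : EuclideanSpace ℝ (Fin d) ≃L[ℝ] (Fin d → ℝ) := EuclideanSpace.equiv (Fin d) ℝ
  have hK : IsCompact (Set.pi Set.univ fun c : Fin d => Icc (l c) (u c)) :=
    isCompact_univ_pi fun _ => isCompact_Icc
  have heq : {x : EuclideanSpace ℝ (Fin d) | ∀ c, x c ∈ Icc (l c) (u c)} =
      Ψ ⁻¹' (Set.pi Set.univ fun c : Fin d => Icc (l c) (u c)) := by
    ext x
    simp only [mem_setOf_eq, mem_preimage, mem_univ_pi]
    rfl
  rw [heq]
  exact Ψ.toHomeomorph.isCompact_preimage.2 hK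

omit [NeZero d] in
/-- A real test function supported in an open coordinate box has compact support. -/
theorem hasCompactSupport_of_tsupport_subset_box {g : 𝓢(EuclideanSpace ℝ (Fin d), ℝ)} {l u : Fin d → ℝ}
    (hg : tsupport (g : EuclideanSpace ℝ (Fin d) → ℝ) ⊆ {x | ∀ c, x c ∈ Ioo (l c) (u c)}) :
    HasCompactSupport (g : EuclideanSpace ℝ (Fin d) → ℝ) :=
  IsCompact.of_isClosed_subset (isCompact_coordBox l u) (isClosed_tsupport _)
    (hg.trans fun _ hx c => Ioo_subset_Icc_self (hx c))

/-- One piece of the lattice partition of a staggered translate of a time-ordered test function lies in the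
closed span of `slabOrderedCompactProducts` (the tree's
`IsTimeOrdered.smulLeftCLM_latticeBump_translate_mem_closure`, keeping the compact supports the box engine
`mem_closure_span_boxTensors` provides). -/
theorem smulLeftCLM_latticeBump_translate_mem_closure_compact
    {F : 𝓢((Fin n → EuclideanSpace ℝ (Fin d)), ℂ)} (hF : IsTimeOrdered F) {T h : ℝ} (hh : 0 < h)
    (hhT : 8 * h ≤ T) (β : Fin (n * d) → ℤ) :
    SchwartzMap.smulLeftCLM ℂ (fun y => ((latticeBump (meshCoord n d h hh) β y : ℝ) : ℂ))
        (SchwartzMap.compSubConstCLM ℂ (T • staggerVec n d) F) ∈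
      closure (Submodule.span ℂ (slabOrderedCompactProducts d n) :
        Set 𝓢((Fin n → EuclideanSpace ℝ (Fin d)), ℂ)) := by
  -- adapted from `IsTimeOrdered.smulLeftCLM_latticeBump_translate_mem_closure`
  -- (Literature/QuantumLattice/SchwartzOrderedWedgeDensity): verbatim up to the last step, where the compact
  -- support of the box-tensor factors is recorded instead of forgotten
  set FT := SchwartzMap.compSubConstCLM ℂ (T • staggerVec n d) F
  set G := SchwartzMap.smulLeftCLM ℂ (fun y => ((latticeBump (meshCoord n d h hh) β y : ℝ) : ℂ)) FT
    with hG
  have hT : 0 ≤ T := by linarith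
  obtain ⟨b, hb⟩ : ∃ b : Fin n × Fin d → ℝ, ∀ ic, b ic = ((β (finProdFinEquiv ic) : ℤ) : ℝ) :=
    ⟨_, fun _ => rfl⟩
  have hbox : ∀ v ∈ tsupport (G : (Fin n → EuclideanSpace ℝ (Fin d)) → ℂ), ∀ ic : Fin n × Fin d,
      b ic * h - h ≤ v ic.1 ic.2 ∧ v ic.1 ic.2 ≤ b ic * h + h := by
    intro v hv ic
    have h1 := (SchwartzMap.tsupport_smulLeftCLM_subset (F := ℂ) _ FT hv).2
    rw [tsupport_latticeBumpC (meshCoord n d h hh) β] at h1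
    have h2 := tsupport_latticeBump_subset (meshCoord n d h hh) β h1 (finProdFinEquiv ic)
    rw [meshCoord_apply, mem_Icc, ← hb ic] at h2
    constructor
    · have h3 : b ic - 1 ≤ v ic.1 ic.2 / h := by linarith [h2.1]
      rw [le_div_iff₀ hh] at h3
      linarith
    · have h3 : v ic.1 ic.2 / h ≤ b ic + 1 := by linarith [h2.2]
      rw [div_le_iff₀ hh] at h3
      linarith
  by_cases hG0 : G = 0
  · rw [hG0]
    exact subset_closure (Submodule.zero_mem _)
  obtain ⟨v, hv⟩ : ∃ v, G v ≠ 0 := by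
    by_contra hcon
    push Not at hcon
    exact hG0 (SchwartzMap.ext hcon)
  have hvbox := hbox v (subset_tsupport _ hv)
  have hFTv : FT v ≠ 0 := by
    rw [hG, SchwartzMap.smulLeftCLM_apply_apply
      (hasTemperateGrowth_latticeBumpC (meshCoord n d h hh) β)] at hv
    exact right_ne_zero_of_smul hv
  obtain ⟨hvpos, hvord⟩ := hF.margins_of_translate_ne_zero hT hFTv
  have hlo : ∀ i, 0 < b (i, 0) * h - 2 * h := fun i => by
    have h1 := hvpos i
    have h2 := (hvbox (i, 0)).2
    dsimp only at h2
    linarith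
  have hord : ∀ i j, i < j → b (i, 0) * h + 2 * h < b (j, 0) * h - 2 * h := fun i j hij => by
    have h1 := hvord i j hij
    have h2 := (hvbox (i, 0)).1
    have h3 := (hvbox (j, 0)).2
    dsimp only at h2 h3
    linarith
  let B : BoxData n d :=
    { l := fun ic => b ic * h - 2 * h, u := fun ic => b ic * h + 2 * h
      l' := fun ic => b ic * h - h, u' := fun ic => b ic * h + h
      hl := fun ic => by linarith, hl' := fun ic => by linarith, hu := fun ic => by linarith }
  let Λ₀ : EuclideanSpace ℝ (Fin d) ≃L[ℝ] EuclideanSpace ℝ (Fin d) := ContinuousLinearEquiv.refl ℝ _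
  have hF' : tsupport (G : (Fin n → EuclideanSpace ℝ (Fin d)) → ℂ) ⊆
      {v | ∀ ic : Fin n × Fin d, (Λ₀ (v ic.1)) ic.2 ∈ Icc (B.l' ic) (B.u' ic)} :=
    fun v hv ic => hbox v hv ic
  refine closure_mono (Submodule.span_mono ?_) (mem_closure_span_boxTensors Λ₀ B G hF')
  rintro P ⟨g, hg, hP⟩
  refine ⟨g, fun i => b (i, 0) * h - 2 * h, fun i => b (i, 0) * h + 2 * h, hP, hlo,
    fun i => by linarith, hord, fun i x hx => ?_, fun i => ?_⟩
  · have h1 := hg i hx 0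
    exact ⟨h1.1.le, h1.2.le⟩
  · exact hasCompactSupport_of_tsupport_subset_box (l := fun c => B.l (i, c)) (u := fun c => B.u (i, c))
      (hg i)

/-- **Ordered-wedge density with compact supports.** Every time-ordered `n`-point test function lies in the
closure of the `ℂ`-span of the slab-ordered real product tensors WITH COMPACTLY SUPPORTED FACTORS (the tree's
`IsTimeOrdered.mem_closure_span_slabOrderedProducts` with the compact supports kept). -/
theorem mem_closure_span_slabOrderedCompactProducts
    {F : 𝓢((Fin n → EuclideanSpace ℝ (Fin d)), ℂ)} (hF : IsTimeOrdered F) :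
    F ∈ closure (Submodule.span ℂ (slabOrderedCompactProducts d n) :
      Set 𝓢((Fin n → EuclideanSpace ℝ (Fin d)), ℂ)) := by
  -- adapted from `IsTimeOrdered.mem_closure_span_slabOrderedProducts`
  -- (Literature/QuantumLattice/SchwartzOrderedWedgeDensity), verbatim with the compact variant of the pieces
  have hC : IsClosed (closure (Submodule.span ℂ (slabOrderedCompactProducts d n) :
      Set 𝓢((Fin n → EuclideanSpace ℝ (Fin d)), ℂ))) := isClosed_closure
  refine hC.mem_of_tendsto (tendsto_compSubConstCLM_staggerVec F)
    (eventually_nhdsWithin_of_forall fun T hT => ?_)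
  have hT : (0 : ℝ) < T := hT
  set FT := SchwartzMap.compSubConstCLM ℂ (T • staggerVec n d) F
  have hh : (0 : ℝ) < T / 8 := by positivity
  set Λ := meshCoord n d (T / 8) hh
  have hlim : Tendsto (fun R : ℕ => ∑ β ∈ latticeCube (n * d) R,
      SchwartzMap.smulLeftCLM ℂ (fun y => ((latticeBump Λ β y : ℝ) : ℂ)) FT) atTop (𝓝 FT) := by
    have hsum : ∀ R : ℕ, ∑ β ∈ latticeCube (n * d) R,
        SchwartzMap.smulLeftCLM ℂ (fun y => ((latticeBump Λ β y : ℝ) : ℂ)) FT =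
          SchwartzMap.smulLeftCLM ℂ (fun y => ((latticeWindow Λ R y : ℝ) : ℂ)) FT := by
      intro R
      have hW : (fun y => ((latticeWindow Λ R y : ℝ) : ℂ)) =
          fun y => ∑ β ∈ latticeCube (n * d) R, ((latticeBump Λ β y : ℝ) : ℂ) := by
        funext y
        rw [← sum_latticeCube_latticeBump Λ R y, Complex.ofReal_sum]
      rw [hW, SchwartzMap.smulLeftCLM_sum fun β _ => hasTemperateGrowth_latticeBumpC Λ β,
        FunLike.coe_sum, Finset.sum_apply]
    simp_rw [hsum]
    exact tendsto_latticeWindow_smul Λ ℂ FT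
  refine hC.mem_of_tendsto hlim (Eventually.of_forall fun R => ?_)
  exact (Submodule.span ℂ (slabOrderedCompactProducts d n)).topologicalClosure.sum_mem fun β _ =>
    smulLeftCLM_latticeBump_translate_mem_closure_compact hF hh (by linarith) β

end Density

section DensityStub

variable {d : ℕ} [NeZero d] {n : ℕ}

/-- **Sub-goal `stub_rpClosure_density` of `stub_rpClosure` (ordered-wedge density with compact supports).** Every
time-ordered test function is a Schwartz limit of finite `ℂ`-combinations of slab-ordered real product tensors with
compactly supported factors. -/
theorem stub_rpClosure_density :
    ∀ {d : ℕ} [NeZero d] {n : ℕ} {F : 𝓢((Fin n → EuclideanSpace ℝ (Fin d)), ℂ)}, IsTimeOrdered F →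
      F ∈ closure (Submodule.span ℂ (slabOrderedCompactProducts d n) :
        Set 𝓢((Fin n → EuclideanSpace ℝ (Fin d)), ℂ)) :=
  fun hF => mem_closure_span_slabOrderedCompactProducts hF

end DensityStub

end RpClosure

end Summit.QuantumFields.YangMills.Cruxes.DiagonalMirrorRPR.ParityBridgeColdTraces

end
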